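import Literature.NumberTheory.Rogawski1990.ArchBouazizWallSetJetBound               -- ★ (this seat) (S7b-1): `exists_nhds_forall_norm_iteratedFDeriv_expFactor_mul_le`, generic jet bounds
import Literature.NumberTheory.Rogawski1990.ArchBouazizStableFamilyModelIdentity      -- ★ p851080 (LH4-p03 (g5)): `iteratedFDeriv_stOrbFamH_eq_model`, `expFactor_mul_apply_flipSet`, `contDiff_flipUnit`
import Literature.NumberTheory.Rogawski1990.ArchBouazizStableFamilyBounded            -- ★ p850876 (LH3-p01 (g4)): `bddAbove_image_inter_of_forall_nhds` (LOCAL-TO-GLOBAL)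
import Literature.NumberTheory.Rogawski1990.ArchBouazizSmoothBoundedSlab              -- ★ p850118 (LH3-p01 (g3)): `archBzSmoothBounded_stOrbFamH_of_slab_zero`, `mem_inRegS_of_mem_slab`
import HarnessLib

/-!
# BOUAZIZ (I₁)+(I₂) FOR THE STABLE ORBITAL FAMILY OF A GENERAL TEST FUNCTION, FROM THE `k`-FOLD CASIMIR ENGINE: `Inv ⟹ ArchBzSmoothBounded (stOrbFamH L νH fH)`
# (stage (α4-S7b), part 2 = the `h2` assembly of `ALPHA4-DESIGN.v1.md`; Bouaziz 1994 §3.1, Shelstad 1979 §4, Varadarajan 1989 §6.4)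

Topic `NumberTheory/Rogawski1990`; namespace `Literature.NumberTheory.Rogawski1990`.  THEOREMS ONLY (no `def`, no instance, no axiom, no `sorry`).  Cell `pub/hodgecm-mathlib`,
crux H413 (`stmt-HodgeConjecture-24833`), line LH3 (closer stub `stub_N9`, DIRECT ROAD), letter L3′ organ O-L3′ conjunct (ii) for GENERAL `fH`.  Author LH3-p01 (g5) ((α4) spec owner).
Count-neutral.

THE RESULT.  **`archBzSmoothBounded_stOrbFamH_of_multiWallInv`**: for `fH ∈ C_c^∞(H_∞)` (★ `ArchSmooth₂`) and a Haar measure `νH`, IF the `k`-fold Casimir engine holds for every finite set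
`P₀` of complex places and every family of Haar measures on the `U(Φ₂)_w`, `w ∈ P₀` (`hInv` = LH10-p01's `Inv ι`, (α4-S6), frozen text v4 `MultiWallInvFrozen` BYTE-FOR-BYTE at `ι := ↥P₀`,
`wl := Subtype.val`, centre `z := 1`: JOINT `(ψ, v)`-jets of `(ψ, v) ↦ (∏ 2 sin ψ_i) · ∫ Φ(v, (↑↑(h_i · P t_1(ψ_i) P⁻¹ · h_i⁻¹))_i) d(⊗ν)` bounded on the open signed unit cube times any
compact, for every smooth slot `V`, Banach `E`, jointly smooth `Φ` of one compact matrix support), THEN the normalised stable orbital family `stOrbFamH L νH fH` satisfies Bouaziz's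
clauses (I₁)+(I₂) (★ `ArchBzSmoothBounded`: `C^∞` on `InRegS S` with all jets bounded on `K ∩ InRegS S`, every chart `S`, every compact `K`).
ROUTE (the (α4) design, all stages now ★): ★ (SB-H) `archBzSmoothBounded_stOrbFamH_of_slab_zero` reduces to the slab-zero clauses; `h1` = ★ [C1b] `contDiffOn_stOrbFamH_slab_zero`;
`h2` (§2 `bddAbove_norm_iteratedFDeriv_stOrbFamH_image_of_multiWallInv`) = ★ LOCAL-TO-GLOBAL `bddAbove_image_inter_of_forall_nhds` over the LOCAL bound (§1
`exists_nhds_forall_norm_iteratedFDeriv_stOrbFamH_le_of_multiWallInv`): at `c₁`, the smooth model of ★ p850992 (`stOrbFamH = K₀ · E_S · Σ_T I ∘ flipSet T` on `InRegS S`,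
★ `iteratedFDeriv_stOrbFamH_eq_model`), the `T`-reduction ★ `expFactor_mul_apply_flipSet` (`E_S · I ∘ flipSet T = u_T · G₀ ∘ flipSet T`, `G₀ = E_S · I`, `u_T` a smooth unit), the local
jet bound of `G₀` at each flipped base point `flipSet T c₁` (★ (S7b-1) `exists_nhds_forall_norm_iteratedFDeriv_expFactor_mul_le`, which is where `hInv` enters), pulled back along the linear
`flipSet T` and multiplied by `u_T` (★ generic jet bounds).
HONEST LABEL: HC_CM is proved only modulo the 7 printed citations (2 remaining: hLiu418 = stmt-HodgeConjecture-24832, h413 = stmt-HodgeConjecture-24833) until rung 0 closes; this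
theorem is CONDITIONAL on `hInv` — the `k`-fold engine (LH10-p01 (g4), (α4-S6), in flight); when it lands, organ O-L3′ conjunct (ii) `ArchBzSmoothBounded (stOrbFamH L νH fH)` for
GENERAL `fH` follows by `modus ponens`.

## References
* [Bouaziz1994IntegralesOrbitales] A. Bouaziz, *Intégrales orbitales sur les algèbres de Lie réductives*, Invent. Math. 115 (1994), §3.1 (I₁)(I₂) p. 579; §6.2 p. 591.
* [Shelstad1979] D. Shelstad, *Characters and inner forms of a quasi-split group over ℝ*, Compositio Math. 39 (1979), §4 pp. 22–25.
* [Varadarajan1989] V. S. Varadarajan, *An Introduction to Harmonic Analysis on Semisimple Lie Groups*, Cambridge Stud. Adv. Math. 16 (1989), §6.4 Thms 22–24.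
* [HormanderALPDO1] L. Hörmander, *The Analysis of Linear Partial Differential Operators I* (1990), §1.1 Thms. 1.1.6–1.1.9.
* [Rogawski1990] J. D. Rogawski, *Automorphic Representations of Unitary Groups in Three Variables*, Ann. of Math. Stud. 123 (1990), §8.2 pp. 119–122.
-/

set_option autoImplicit false

noncomputable section

open MeasureTheory Measure Filter Topology Set Function NumberField NumberField.InfinitePlace NumberField.mixedEmbedding Matrix Complex BoundedContinuousFunction
open Literature.NumberTheory.Automorphic Literature.NumberTheory.Automorphic.UnitaryGroup Literature.NumberTheory.Automorphic.ArchCartan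
open scoped ContDiff MatrixGroups Matrix Classical ENNReal NNReal
open scoped Matrix.Norms.Operator

namespace Literature.NumberTheory.Rogawski1990

local notation3 "Φ₂[" L "]" => (Matrix.of fun i j : Fin 2 => if i.val + j.val + 1 = 2 then (1 : L) else 0)
local notation3 "Φ₁[" L "]" => (Matrix.of fun i j : Fin 1 => if i.val + j.val + 1 = 1 then (1 : L) else 0)
local notation3 "𝔸[" L "]" => ↥(arch (↥(maximalRealSubfield L)) L (IsCMField.complexConj L) 2 Φ₂[L])
local notation3 "𝔹[" L "]" => ↥(arch (↥(maximalRealSubfield L)) L (IsCMField.complexConj L) 1 Φ₁[L])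

/-! ## §0 `flipSet T` is a continuous linear map -/

section Flip

variable {W : Type*} [Fintype W] [DecidableEq W]

/-- **`flipSet T` is `ℝ`-linear and continuous** (it swaps the slots `0` and `2` at the places of `T`): there is a continuous linear `A` with `A c = flipSet T c` for all `c`.
[cite: Shelstad1979, §4 p. 23] -/
theorem exists_clm_eq_flipSet (T : Finset W) : ∃ A : (W → Fin 3 → ℝ) →L[ℝ] (W → Fin 3 → ℝ), ∀ c, A c = flipSet T c := by
  refine ⟨LinearMap.toContinuousLinearMap
    { toFun := flipSet T
      map_add' := fun a b => ?_
      map_smul' := fun r a => ?_ }, fun c => rfl⟩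
  · funext w j
    simp only [flipSet, Pi.add_apply]
    split_ifs with h
    · fin_cases j <;> simp
    · rfl
  · funext w j
    simp only [flipSet, Pi.smul_apply, smul_eq_mul, RingHom.id_apply]
    split_ifs with h
    · fin_cases j <;> simp
    · rfl

end Flip

/-! ## §1 The local bound of the jets of `stOrbFamH` at a base point, modulo the engine -/

section Local

variable (L : Type) [Field L] [NumberField L] [IsCMField L]
  [∀ w : {w : InfinitePlace L // IsComplex w}, MeasurableSpace ↥(archLocal L 2 Φ₂[L] w)]
  [∀ w : {w : InfinitePlace L // IsComplex w}, BorelSpace ↥(archLocal L 2 Φ₂[L] w)]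
  [MeasurableSpace 𝔸[L]] [BorelSpace 𝔸[L]] [MeasurableSpace 𝔹[L]] [BorelSpace 𝔹[L]]
  (νH : Measure (𝔸[L] × 𝔹[L])) [νH.IsHaarMeasure] [νH.IsMulRightInvariant]

set_option maxHeartbeats 800000 in
/-- **LOCAL BOUND OF ALL JETS OF THE STABLE ORBITAL FAMILY AT ANY BASE POINT, CONDITIONAL ON THE `k`-FOLD ENGINE**: for `fH ∈ C_c^∞(H_∞)`, `νH` Haar, a chart `S`, an order `n` and a point
`c₁`, `∃ U ∈ 𝓝 c₁, ∃ B, ∀ c ∈ U ∩ InRegS S, ‖iteratedFDeriv ℝ n (stOrbFamH L νH fH S) c‖ ≤ B` — the smooth model (★ p850992) + the `T`-reduction (★ p851080) + the local jet bound of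
`G₀ = E_S · I` at the `2^{#Sᶜ}` flipped base points (★ (S7b-1), where `hInv` enters) + linear pull-back along `flipSet T` and Leibniz with the unit `u_T`.
[cite: Bouaziz1994IntegralesOrbitales, §3.1 (I₂) p. 579; §6.2 p. 591] [cite: Shelstad1979, §4 pp. 22–25] [cite: Varadarajan1989, §6.4 Thms 22–23] [cite: HormanderALPDO1, §1.1 Thms. 1.1.6–1.1.9] -/
theorem exists_nhds_forall_norm_iteratedFDeriv_stOrbFamH_le_of_multiWallInv {fH : 𝔸[L] × 𝔹[L] → ℂ} (hfH : ArchSmooth₂ L fH)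
    (hInv : ∀ (P₀ : Finset {w : InfinitePlace L // IsComplex w}) (ν : ∀ i : ↥P₀, Measure ↥(archLocal L 2 Φ₂[L] i.1))
      [∀ i, (ν i).IsHaarMeasure] [∀ i, (ν i).IsMulRightInvariant],
      ∀ (V : Type) [NormedAddCommGroup V] [NormedSpace ℝ V] [FiniteDimensional ℝ V]
        (E : Type) [NormedAddCommGroup E] [NormedSpace ℝ E] [CompleteSpace E]
        (Φ : V × (↥P₀ → Matrix (Fin 2) (Fin 2) ℂ) → E) (_ : ContDiff ℝ ∞ Φ)
        (KV : Set V) (_ : IsCompact KV) (K : Set (↥P₀ → Matrix (Fin 2) (Fin 2) ℂ)) (_ : IsCompact K)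
        (_ : ∀ (v : V) (Y : ↥P₀ → Matrix (Fin 2) (Fin 2) ℂ), Y ∉ K → Φ (v, Y) = 0) (n : ℕ) (ε : ↥P₀ → Bool),
        ∃ B : ℝ, ∀ ψ : ↥P₀ → ℝ, (∀ i, 0 < (if ε i then ψ i else -ψ i) ∧ (if ε i then ψ i else -ψ i) < 1) → ∀ v ∈ KV,
          ‖iteratedFDeriv ℝ n (fun x : (↥P₀ → ℝ) × V => (∏ i, 2 * Real.sin (x.1 i)) •
              ∫ h : (∀ i : ↥P₀, ↥(archLocal L 2 Φ₂[L] i.1)),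
                Φ (x.2, fun i => (((h i * ⟨Matrix.GeneralLinearGroup.mkOfDetNeZero !![(1 : ℂ), 1; 1, -1] det_cayleyTwo_ne_zero *
                        circleDiagonal 2 ![1 * Circle.exp (x.1 i), 1 * Circle.exp (-(x.1 i))] *
                        (Matrix.GeneralLinearGroup.mkOfDetNeZero !![(1 : ℂ), 1; 1, -1] det_cayleyTwo_ne_zero)⁻¹,
                      cayley_conj_circleDiagonal_mem_archLocal L i.1 _⟩ * (h i)⁻¹ :
                    ↥(archLocal L 2 Φ₂[L] i.1)) : GL (Fin 2) ℂ) : Matrix (Fin 2) (Fin 2) ℂ)) ∂(Measure.pi ν)) (ψ, v)‖ ≤ B)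
    (S : Finset {w : InfinitePlace L // IsComplex w}) (n : ℕ) (c₁ : {w : InfinitePlace L // IsComplex w} → Fin 3 → ℝ) :
    ∃ U ∈ 𝓝 c₁, ∃ B : ℝ, ∀ c ∈ U ∩ InRegS S, ‖iteratedFDeriv ℝ n (stOrbFamH L νH fH S) c‖ ≤ B := by
  haveI : ∀ w : {w : InfinitePlace L // IsComplex w}, LocallyCompactSpace ↥(archLocal L 2 Φ₂[L] w) := fun w => locallyCompactSpace_archLocal_two L w
  haveI : ∀ w : {w : InfinitePlace L // IsComplex w}, SecondCountableTopology ↥(archLocal L 2 Φ₂[L] w) := fun w => secondCountableTopology_archLocal_two L w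
  -- the ambient lift and the package of leaves
  obtain ⟨Θ, hΘ, -, hΘf⟩ := hfH.exists_contDiff
  have hfc : HasCompactSupport fH := ArchSmooth₂.hasCompactSupport L hfH
  obtain ⟨νw, hνH', hνR, K₀, Λw, Zw, hΛfin, hσ, hZcl, hZnull, hexpl, hprop, hid, hI, -, -⟩ := exists_placeLeaves_stOrbFamH_model L S νH hfH
  haveI : ∀ w, (νw w).IsHaarMeasure := hνH'
  haveI : ∀ w, (νw w).IsMulRightInvariant := hνR
  haveI : ∀ w, IsFiniteMeasureOnCompacts (Λw w) := hΛfin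
  haveI : ∀ w, SigmaFinite (Λw w) := hσ
  -- abbreviations: `E_S`, `I`, `G₀ = E_S · I`, `u_T`
  set ES : ({w : InfinitePlace L // IsComplex w} → Fin 3 → ℝ) → ℂ := fun c => ∏ w, (if w ∈ S then ((Real.exp (c w 0) : ℝ) : ℂ) else 1 - (Circle.exp (c w 2 - c w 0) : ℂ))
    with hES_def
  set Il : ({w : InfinitePlace L // IsComplex w} → Fin 3 → ℝ) → ℂ := fun c =>
    ∫ z : ∀ w : {w : InfinitePlace L // IsComplex w}, ↥(archLocal L 2 Φ₂[L] w) × ↥(archLocal L 2 Φ₂[L] w),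
      fH ((archPiEquivCM 2 L Φ₂[L]).symm (fun w => (z w).1 * (endoBlockAt L S w (c w) * (z w).2) * (z w).1⁻¹), (endoTorus L S c).2) ∂(Measure.pi Λw) with hIl_def
  have hG₀ : ContDiffOn ℝ ∞ (fun c => ES c * Il c) (InRegS S) := (contDiff_expFactor S).contDiffOn.mul hI
  -- (1) the local jet bounds of `G₀` at the flipped base points `flipSet T c₁`, all orders `k`
  have hloc : ∀ (T : Finset {w : InfinitePlace L // IsComplex w}) (k : ℕ), ∃ U ∈ 𝓝 (flipSet T c₁), ∃ B : ℝ, ∀ c ∈ U ∩ InRegS S,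
      ‖iteratedFDeriv ℝ k (fun c => ES c * Il c) c‖ ≤ B := fun T k =>
    exists_nhds_forall_norm_iteratedFDeriv_expFactor_mul_le L S hfc hΘ hΘf νw Λw Zw hZcl hZnull hexpl hprop (fun P₀ => hInv P₀ fun i => νw i.1) (flipSet T c₁) k
  choose U hU B hB using hloc
  -- (2) `flipSet T` as a continuous linear map, the flip units
  choose A hA using fun T : Finset {w : InfinitePlace L // IsComplex w} => exists_clm_eq_flipSet T
  have hAcont : ∀ T, Continuous (flipSet T : ({w : InfinitePlace L // IsComplex w} → Fin 3 → ℝ) → _) := fun T => by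
    have h : (flipSet T : ({w : InfinitePlace L // IsComplex w} → Fin 3 → ℝ) → _) = A T := funext fun c => (hA T c).symm
    rw [h]; exact (A T).continuous
  -- (3) the neighbourhood: all flips land in the `U T k`, inside the unit ball around `c₁`
  set V₀ : Set ({w : InfinitePlace L // IsComplex w} → Fin 3 → ℝ) :=
    Metric.ball c₁ 1 ∩ ⋂ T ∈ (Finset.univ \ S).powerset, ⋂ k ∈ Finset.range (n + 1), (flipSet T) ⁻¹' interior (U T k) with hV₀_def
  have hV₀o : IsOpen V₀ := by
    refine Metric.isOpen_ball.inter (isOpen_biInter_finset fun T _ => isOpen_biInter_finset fun k _ => ?_)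
    exact isOpen_interior.preimage (hAcont T)
  have hc₁V₀ : c₁ ∈ V₀ := by
    refine ⟨Metric.mem_ball_self one_pos, Set.mem_iInter₂.2 fun T _ => Set.mem_iInter₂.2 fun k _ => ?_⟩
    exact mem_interior_iff_mem_nhds.2 (hU T k)
  -- bounds for the jets of the units `u_T` on the closed unit ball
  have hub : ∀ (T : Finset {w : InfinitePlace L // IsComplex w}) (i : ℕ), ∃ M : ℝ, ∀ c ∈ Metric.closedBall c₁ 1,
      ‖iteratedFDeriv ℝ i (fun c : {w : InfinitePlace L // IsComplex w} → Fin 3 → ℝ => ∏ w ∈ T, -(Circle.exp (c w 2 - c w 0) : ℂ)) c‖ ≤ M := fun T i =>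
    (isCompact_closedBall c₁ 1).exists_bound_of_continuousOn (((contDiff_flipUnit T).continuous_iteratedFDeriv (by exact_mod_cast le_top)).continuousOn)
  choose M hM using hub
  -- (4) the bound
  refine ⟨V₀, hV₀o.mem_nhds hc₁V₀, ‖(K₀ : ℂ)‖ * ∑ T ∈ (Finset.univ \ S).powerset, ∑ i ∈ Finset.range (n + 1),
    (n.choose i : ℝ) * M T i * (‖A T‖ ^ (n - i) * B T (n - i)), fun c hc => ?_⟩
  obtain ⟨hcV, hcI⟩ := hc
  have hO : IsOpen (V₀ ∩ InRegS S) := hV₀o.inter (isOpen_inRegS S)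
  -- the family equals its flip-unit model on `InRegS S`; jets at `c`
  rw [iteratedFDeriv_stOrbFamH_eq_model L νH fH S hid hI hcI n]
  have hmodel : (fun c : {w : InfinitePlace L // IsComplex w} → Fin 3 → ℝ =>
      (K₀ : ℂ) * (∏ w, (if w ∈ S then ((Real.exp (c w 0) : ℝ) : ℂ) else 1 - (Circle.exp (c w 2 - c w 0) : ℂ))) * ∑ T ∈ (Finset.univ \ S).powerset, Il (flipSet T c)) =
      fun c => (K₀ : ℂ) • ∑ T ∈ (Finset.univ \ S).powerset, (∏ w ∈ T, -(Circle.exp (c w 2 - c w 0) : ℂ)) * (ES (flipSet T c) * Il (flipSet T c)) := by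
    funext c
    rw [smul_eq_mul, mul_assoc]
    congr 1
    rw [Finset.mul_sum]
    refine Finset.sum_congr rfl fun T hT => ?_
    exact expFactor_mul_apply_flipSet S T (not_mem_of_mem_powerset_sdiff hT) Il c
  rw [hmodel]
  -- smoothness of the terms on the open `V₀ ∩ InRegS S`
  have hflipI : ∀ T c', c' ∈ V₀ ∩ InRegS S → flipSet T c' ∈ InRegS S := fun T c' hc' => (flipSet_mem_inRegS_iff S T c').2 hc'.2
  have hterm : ∀ T ∈ (Finset.univ \ S).powerset, ContDiffOn ℝ ∞ (fun c : {w : InfinitePlace L // IsComplex w} → Fin 3 → ℝ =>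
      (∏ w ∈ T, -(Circle.exp (c w 2 - c w 0) : ℂ)) * (ES (flipSet T c) * Il (flipSet T c))) (V₀ ∩ InRegS S) := fun T _ =>
    (contDiff_flipUnit T).contDiffOn.mul (hG₀.comp (contDiff_flipSet T).contDiffOn fun c' hc' => hflipI T c' hc')
  have hsum : ContDiffOn ℝ ∞ (fun c : {w : InfinitePlace L // IsComplex w} → Fin 3 → ℝ =>
      ∑ T ∈ (Finset.univ \ S).powerset, (∏ w ∈ T, -(Circle.exp (c w 2 - c w 0) : ℂ)) * (ES (flipSet T c) * Il (flipSet T c))) (V₀ ∩ InRegS S) :=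
    ContDiffOn.sum hterm
  -- `Dⁿ(K₀ • Σ) = K₀ • Σ Dⁿ`
  rw [iteratedFDeriv_const_smul_apply' (((hsum c ⟨hcV, hcI⟩).contDiffAt (hO.mem_nhds ⟨hcV, hcI⟩)).of_le (by exact_mod_cast le_top)), _root_.norm_smul]
  refine mul_le_mul_of_nonneg_left ?_ (norm_nonneg _)
  have hsum_eq : iteratedFDeriv ℝ n (fun c : {w : InfinitePlace L // IsComplex w} → Fin 3 → ℝ =>
      ∑ T ∈ (Finset.univ \ S).powerset, (∏ w ∈ T, -(Circle.exp (c w 2 - c w 0) : ℂ)) * (ES (flipSet T c) * Il (flipSet T c))) c =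
      ∑ T ∈ (Finset.univ \ S).powerset, iteratedFDeriv ℝ n (fun c : {w : InfinitePlace L // IsComplex w} → Fin 3 → ℝ =>
        (∏ w ∈ T, -(Circle.exp (c w 2 - c w 0) : ℂ)) * (ES (flipSet T c) * Il (flipSet T c))) c := by
    rw [← iteratedFDerivWithin_of_isOpen n hO ⟨hcV, hcI⟩]
    have h := iteratedFDerivWithin_sum_apply (i := n) (u := (Finset.univ \ S).powerset)
      (f := fun T (c : {w : InfinitePlace L // IsComplex w} → Fin 3 → ℝ) => (∏ w ∈ T, -(Circle.exp (c w 2 - c w 0) : ℂ)) * (ES (flipSet T c) * Il (flipSet T c)))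
      hO.uniqueDiffOn ⟨hcV, hcI⟩ fun T hT => ((hterm T hT) c ⟨hcV, hcI⟩).of_le (by exact_mod_cast le_top)
    have hfun : (∑ T ∈ (Finset.univ \ S).powerset, fun c : {w : InfinitePlace L // IsComplex w} → Fin 3 → ℝ =>
        (∏ w ∈ T, -(Circle.exp (c w 2 - c w 0) : ℂ)) * (ES (flipSet T c) * Il (flipSet T c))) =
        fun c => ∑ T ∈ (Finset.univ \ S).powerset, (∏ w ∈ T, -(Circle.exp (c w 2 - c w 0) : ℂ)) * (ES (flipSet T c) * Il (flipSet T c)) := by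
      funext c; simp only [Finset.sum_apply]
    rw [hfun] at h
    rw [h]
    exact Finset.sum_congr rfl fun T _ => iteratedFDerivWithin_of_isOpen n hO ⟨hcV, hcI⟩
  rw [hsum_eq]
  refine (norm_sum_le _ _).trans (Finset.sum_le_sum fun T hT => ?_)
  -- one flip: Leibniz, then pull back along `flipSet T`, then the local bound at `flipSet T c₁`
  have hGT : ContDiffOn ℝ ∞ (fun c => ES (flipSet T c) * Il (flipSet T c)) (V₀ ∩ InRegS S) :=
    hG₀.comp (contDiff_flipSet T).contDiffOn fun c' hc' => hflipI T c' hc'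
  refine (norm_iteratedFDeriv_mul_le_of_isOpen hO (contDiff_flipUnit T).contDiffOn hGT ⟨hcV, hcI⟩ n).trans (Finset.sum_le_sum fun i hi => ?_)
  have hcball : c ∈ Metric.closedBall c₁ 1 := Metric.ball_subset_closedBall hcV.1
  have hflipU : ∀ k ∈ Finset.range (n + 1), flipSet T c ∈ U T k := fun k hk => interior_subset
    ((Set.mem_iInter₂.1 ((Set.mem_iInter₂.1 hcV.2) T hT)) k hk)
  have h1 : ‖iteratedFDeriv ℝ (n - i) (fun c => ES (flipSet T c) * Il (flipSet T c)) c‖ ≤ ‖A T‖ ^ (n - i) * B T (n - i) := by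
    have hfun : (fun c => ES (flipSet T c) * Il (flipSet T c)) = fun c => (fun c' => ES c' * Il c') (A T c + 0) := by
      funext c'; rw [add_zero, hA T c']
    rw [hfun]
    have hx : A T c + 0 ∈ InRegS S := by rw [add_zero, hA T c]; exact (flipSet_mem_inRegS_iff S T c).2 hcI
    refine (norm_iteratedFDeriv_comp_clm_add_le (isOpen_inRegS S) hG₀ (A T) 0 hx (n - i)).trans (mul_le_mul_of_nonneg_left ?_ (pow_nonneg (norm_nonneg _) _))
    rw [add_zero, hA T c]
    exact hB T (n - i) (flipSet T c) ⟨hflipU (n - i) (Finset.mem_range.2 (by omega)), (flipSet_mem_inRegS_iff S T c).2 hcI⟩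
  have h2 := hM T i c hcball
  have hM0 : 0 ≤ M T i := (norm_nonneg _).trans h2
  exact mul_le_mul (mul_le_mul_of_nonneg_left h2 (Nat.cast_nonneg _)) h1 (norm_nonneg _) (mul_nonneg (Nat.cast_nonneg _) hM0)

/-! ## §2 The `h2` clause on `K ∩ slab₀`, and Bouaziz (I₁)+(I₂) -/

/-- **`h2` OF ★ (SB-H) FROM THE ENGINE**: every jet of `stOrbFamH L νH fH S` is bounded on `K ∩ slab₀(S)` for every compact `K` (★ LOCAL-TO-GLOBAL over §1; `slab₀ ⊆ InRegS S`).
[cite: Bouaziz1994IntegralesOrbitales, §3.1 (I₂) p. 579] [cite: Shelstad1979, §4 pp. 22–25] -/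
theorem bddAbove_norm_iteratedFDeriv_stOrbFamH_image_of_multiWallInv {fH : 𝔸[L] × 𝔹[L] → ℂ} (hfH : ArchSmooth₂ L fH)
    (hInv : ∀ (P₀ : Finset {w : InfinitePlace L // IsComplex w}) (ν : ∀ i : ↥P₀, Measure ↥(archLocal L 2 Φ₂[L] i.1))
      [∀ i, (ν i).IsHaarMeasure] [∀ i, (ν i).IsMulRightInvariant],
      ∀ (V : Type) [NormedAddCommGroup V] [NormedSpace ℝ V] [FiniteDimensional ℝ V]
        (E : Type) [NormedAddCommGroup E] [NormedSpace ℝ E] [CompleteSpace E]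
        (Φ : V × (↥P₀ → Matrix (Fin 2) (Fin 2) ℂ) → E) (_ : ContDiff ℝ ∞ Φ)
        (KV : Set V) (_ : IsCompact KV) (K : Set (↥P₀ → Matrix (Fin 2) (Fin 2) ℂ)) (_ : IsCompact K)
        (_ : ∀ (v : V) (Y : ↥P₀ → Matrix (Fin 2) (Fin 2) ℂ), Y ∉ K → Φ (v, Y) = 0) (n : ℕ) (ε : ↥P₀ → Bool),
        ∃ B : ℝ, ∀ ψ : ↥P₀ → ℝ, (∀ i, 0 < (if ε i then ψ i else -ψ i) ∧ (if ε i then ψ i else -ψ i) < 1) → ∀ v ∈ KV,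
          ‖iteratedFDeriv ℝ n (fun x : (↥P₀ → ℝ) × V => (∏ i, 2 * Real.sin (x.1 i)) •
              ∫ h : (∀ i : ↥P₀, ↥(archLocal L 2 Φ₂[L] i.1)),
                Φ (x.2, fun i => (((h i * ⟨Matrix.GeneralLinearGroup.mkOfDetNeZero !![(1 : ℂ), 1; 1, -1] det_cayleyTwo_ne_zero *
                        circleDiagonal 2 ![1 * Circle.exp (x.1 i), 1 * Circle.exp (-(x.1 i))] *
                        (Matrix.GeneralLinearGroup.mkOfDetNeZero !![(1 : ℂ), 1; 1, -1] det_cayleyTwo_ne_zero)⁻¹,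
                      cayley_conj_circleDiagonal_mem_archLocal L i.1 _⟩ * (h i)⁻¹ :
                    ↥(archLocal L 2 Φ₂[L] i.1)) : GL (Fin 2) ℂ) : Matrix (Fin 2) (Fin 2) ℂ)) ∂(Measure.pi ν)) (ψ, v)‖ ≤ B)
    (S : Finset {w : InfinitePlace L // IsComplex w}) (n : ℕ) {K : Set ({w : InfinitePlace L // IsComplex w} → Fin 3 → ℝ)} (hK : IsCompact K) :
    BddAbove ((fun c => ‖iteratedFDeriv ℝ n (stOrbFamH L νH fH S) c‖) '' (K ∩ {c | ∀ w, w ∉ S → 0 < c w 0 - c w 2 ∧ c w 0 - c w 2 < 2 * Real.pi})) := by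
  refine bddAbove_image_inter_of_forall_nhds hK fun c₁ _ => ?_
  obtain ⟨U, hU, B, hB⟩ := exists_nhds_forall_norm_iteratedFDeriv_stOrbFamH_le_of_multiWallInv L νH hfH hInv S n c₁
  refine ⟨U, hU, B, ?_⟩
  rintro _ ⟨c, ⟨hcU, hc⟩, rfl⟩
  refine hB c ⟨hcU, mem_inRegS_of_mem_slab S (fun _ => 0) fun w hw => ?_⟩
  simpa using hc w hw

/-- **BOUAZIZ (I₁)+(I₂) FOR THE STABLE ORBITAL FAMILY OF A GENERAL TEST FUNCTION, FROM THE `k`-FOLD CASIMIR ENGINE**: `fH ∈ C_c^∞(H_∞)`, `νH` Haar, and the engine `hInv` for every wall set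
⇒ `ArchBzSmoothBounded (stOrbFamH L νH fH)` (★ (SB-H) reduction + ★ [C1b] `h1` + `h2` above).  The organ O-L3′ conjunct (ii) for GENERAL `fH`, conditional on (α4-S6).
[cite: Bouaziz1994IntegralesOrbitales, §3.1 (I₁)(I₂) p. 579; §6.2 p. 591] [cite: Shelstad1979, §4 pp. 22–25] [cite: Varadarajan1989, §6.4 Thms 22–24] -/
theorem archBzSmoothBounded_stOrbFamH_of_multiWallInv {fH : 𝔸[L] × 𝔹[L] → ℂ} (hfH : ArchSmooth₂ L fH)
    (hInv : ∀ (P₀ : Finset {w : InfinitePlace L // IsComplex w}) (ν : ∀ i : ↥P₀, Measure ↥(archLocal L 2 Φ₂[L] i.1))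
      [∀ i, (ν i).IsHaarMeasure] [∀ i, (ν i).IsMulRightInvariant],
      ∀ (V : Type) [NormedAddCommGroup V] [NormedSpace ℝ V] [FiniteDimensional ℝ V]
        (E : Type) [NormedAddCommGroup E] [NormedSpace ℝ E] [CompleteSpace E]
        (Φ : V × (↥P₀ → Matrix (Fin 2) (Fin 2) ℂ) → E) (_ : ContDiff ℝ ∞ Φ)
        (KV : Set V) (_ : IsCompact KV) (K : Set (↥P₀ → Matrix (Fin 2) (Fin 2) ℂ)) (_ : IsCompact K)
        (_ : ∀ (v : V) (Y : ↥P₀ → Matrix (Fin 2) (Fin 2) ℂ), Y ∉ K → Φ (v, Y) = 0) (n : ℕ) (ε : ↥P₀ → Bool),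
        ∃ B : ℝ, ∀ ψ : ↥P₀ → ℝ, (∀ i, 0 < (if ε i then ψ i else -ψ i) ∧ (if ε i then ψ i else -ψ i) < 1) → ∀ v ∈ KV,
          ‖iteratedFDeriv ℝ n (fun x : (↥P₀ → ℝ) × V => (∏ i, 2 * Real.sin (x.1 i)) •
              ∫ h : (∀ i : ↥P₀, ↥(archLocal L 2 Φ₂[L] i.1)),
                Φ (x.2, fun i => (((h i * ⟨Matrix.GeneralLinearGroup.mkOfDetNeZero !![(1 : ℂ), 1; 1, -1] det_cayleyTwo_ne_zero *
                        circleDiagonal 2 ![1 * Circle.exp (x.1 i), 1 * Circle.exp (-(x.1 i))] *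
                        (Matrix.GeneralLinearGroup.mkOfDetNeZero !![(1 : ℂ), 1; 1, -1] det_cayleyTwo_ne_zero)⁻¹,
                      cayley_conj_circleDiagonal_mem_archLocal L i.1 _⟩ * (h i)⁻¹ :
                    ↥(archLocal L 2 Φ₂[L] i.1)) : GL (Fin 2) ℂ) : Matrix (Fin 2) (Fin 2) ℂ)) ∂(Measure.pi ν)) (ψ, v)‖ ≤ B) :
    ArchBzSmoothBounded (stOrbFamH L νH fH) :=
  archBzSmoothBounded_stOrbFamH_of_slab_zero L νH fH (contDiffOn_stOrbFamH_slab_zero L νH hfH)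
    fun S n _ hK => bddAbove_norm_iteratedFDeriv_stOrbFamH_image_of_multiWallInv L νH hfH hInv S n hK

end Local

end Literature.NumberTheory.Rogawski1990

end
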